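import Summits.RiemannHypothesis.RiemannHypothesis.Theorems.GroundBartaEvenWinsBeyondArchDeflationUpperY
import Summits.RiemannHypothesis.RiemannHypothesis.Theorems.GroundBartaEvenWinsBeyondArchArchM77YW77e1
import HarnessLib

/-!
# The parity ladder beyond `log 2`: U-side at `b = 77/100` — `ε(77/100) ≤ 1/(32·10¹²)`

Support file (GroundBarta rung 4 / WeilParity item stmt-RiemannHypothesis-18085, helper), RH-free.  Prover A (gen 2).
Rayleigh–Ritz upper bound at the window `77/100` from the A-layer certificates of the even degree-`26` trial vector `w77e1`
(`w77e1_T`), the exact norm and the Markov bracket `m77_markov_mem`: `ε(77/100) ≤ 3.058526e-14 ≤ 1/(32·10¹²)`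
(`dt_groundEnergy_le_of_T`).  U-side of the cell `[77/100, ·]`.
-/

set_option linter.dupNamespace false

noncomputable section

namespace Summit.RiemannHypothesis.RiemannHypothesis.Theorems.EvenWinsBeyondArch

open Literature.NumberTheory.LFunctions Literature.Analysis.ValidatedNumerics.ExpPoly
open Literature.Analysis.ValidatedNumerics.PolyMP Summit.RiemannHypothesis.RiemannHypothesis.Theorems.EvenWinsBeyondArch.ArchM77Y

set_option maxHeartbeats 0 in
/-- The exact `∫_{-1}^{1} P²` of the U-side trial vector at `77/100`. [folklore] -/
theorem w77e1_IQ : integPolyQ w77e1P w77e1P 1 = ((4645499058884335935918546535208174597727204298071194798374504763 : ℚ)/3577034275340938670657722998027086286216219697294778986974412800) := by decide +kernel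

/-- **`ε(77/100) ≤ 1/(32·10¹²)`** (U-side at `77/100`). [folklore] -/
theorem trialUpper77 : weilGroundEnergy (77 / 100 : ℝ) ≤ (1 / 32000000000000 : ℝ) := by
  have hT := w77e1_T
  have hM := m77_markov_mem
  have h := dt_groundEnergy_le_of_T w77e1P w77e1E (b := 77 / 100) (by norm_num) w77e1_hE
    (Thi := 650663885796091071356938481406687620251392684817254562280800005768922074585325884990342274378017045530990394547050567769209135164323271436941/78259755035113476009419150550177790068440414142515380224000000000000000000000000000000000000000000000000000000000000000000000000000000000000) (Mlo := 8314156944449285937 / 1000000000000000000)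
    (by push_cast at hT ⊢; exact hT.2) (by push_cast at hM ⊢; exact hM.1) (by rw [w77e1_IQ]; norm_num)
  rw [w77e1_IQ] at h
  push_cast at h
  refine le_trans h ?_
  norm_num

end Summit.RiemannHypothesis.RiemannHypothesis.Theorems.EvenWinsBeyondArch

end
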